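/-
Copyright (c) 2026 the pub-hodgecm-mathlib formalisation cell (harness21).  Prover seat hodgecm-mathlib-A-p03 (g24); LEAD F0P3a-plan (g9) WORD T8-81 «LAYER B_H»;
κ = +1 (`T_H`) VALUE with B-p12 (g28)'s `hMars` (★ `UnitaryThreeRamifiedTorusMars`) and weight′ (★ `UnitaryThreeRamifiedTorusDoubleCosetsHKWeight`) discharged, 2026-09-01.
-/
import Literature.NumberTheory.Rogawski1990.UnitOrbitalIntegralInertValueTHClosed
import Literature.NumberTheory.Automorphic.UnitaryThreeRamifiedTorusMars                     -- ★ B-p12: `exists_ramifiedMars_coords`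
import Literature.NumberTheory.Automorphic.UnitaryThreeRamifiedTorusDoubleCosetsHKWeight      -- ★ B-p12: `relIndex_flickerKH_conj_ramifiedRep_eq`
import HarnessLib

/-!
# κ = +1 (`T_H`) VALUE, binder-free: `#{q ∈ U⧸K : t′ q = q} = phiTHM q N₊ N` over the lattice bridge only

Topic `NumberTheory/Rogawski1990` (road «D-N7-inert», MAP v3 (F11) κ = +1 value, input of `stub_irredGValuePos`); namespace
`Literature.NumberTheory.Automorphic.UnitaryGroup`.  THEOREMS ONLY; kernel lane.

★ `natCard_fixedPoints_unitaryInt_ramifiedTorus_eq_phiTHM_of_bridge` (p841886) carried B-p12's `hMars` (K-side Mars for the ramified order) and `hweight`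
(`relIndex = q^n`) as binders; both are now ★ (`exists_ramifiedMars_coords` p841922, `relIndex_flickerKH_conj_ramifiedRep_eq` p841900).  This file plugs them in:
**`natCard_fixedPoints_unitaryInt_ramifiedTorus_eq_phiTHM_final`** — hypotheses = the frame (`hJ hd hσO hy hc u hu`), the lattice bridge `(R, ι, σR, dR, ϖR)` with
`#k_R = q²`, the literal `t′` with `B = Cρ`, `|ρ| = |ϖ|`, `σρ = ρ`, `|C| = |ϖ^N|`, `|A − b₀| = |ϖ^{N₊}|`, B-p12's representatives `r`, `#k_{𝒪[K]} = q²`, `ha₀`, `hfin`.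
HONEST LABEL: HC_CM is proved only modulo the printed citations until rung 0 closes.

## References
* [Flicker1998UnitaryFL] Y. Z. Flicker, *Elementary proof of the fundamental lemma for a unitary group*, Canad. J. Math. 50 (1998), 74–98: Prop. 5 p. 82, Prop. 6 p. 83,
  Prop. 7 p. 84, Cor. 9 p. 85, Prop. 10 p. 85, Prop. 11 p. 87.
* [Rogawski1990] J. D. Rogawski, *Automorphic Representations of Unitary Groups in Three Variables* (1990), §4.9 p. 55.
-/

set_option autoImplicit false

open scoped MatrixGroups WithZero Valued
open Matrix

universe u

namespace Literature.NumberTheory.Automorphic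

namespace UnitaryGroup

open Literature.NumberTheory.Automorphic.HermitianLattice (unitaryInt mem_unitaryInt_iff LocalConjDatum)
open Literature.NumberTheory.Rogawski1990.Flicker1998 (phiTHM)
open IsLocalRing

variable {K : Type*} [Field K] [Valued K ℤᵐ⁰] {ϖ : K} (σ : K →+* K) {J : Matrix (Fin 3) (Fin 3) K}

section THFinal

variable [IsDiscreteValuationRing 𝒪[K]] [Finite (ResidueField 𝒪[K])] [IsAdicComplete (maximalIdeal 𝒪[K]) 𝒪[K]]

set_option synthInstance.maxHeartbeats 200000 in
-- the `H`-action on `H ⧸ (K^{u_m} ∩ H)` is found through the large subgroup terms of the `U(2,1)` frame (as in ★ (F2))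
/-- **κ = +1 (`T_H`) VALUE, binder-free**: `#{q ∈ U⧸K : t′ q = q} = phiTHM q N₊ N` for B-p12's ramified-torus literal `t′` and representatives `r`, over the
lattice bridge `(R, ι, σR, dR, ϖR)`. [cite: Flicker1998UnitaryFL, Prop. 5 p. 82, Cor. 9 p. 85, Prop. 10 p. 85, Prop. 11 p. 87] -/
theorem natCard_fixedPoints_unitaryInt_ramifiedTorus_eq_phiTHM_final (hJ : J = (StdForm.antidiagonal 3).over K) (hd : LocalConjDatum σ ϖ)
    (hσO : ∀ y : 𝒪[K], (σ.comp 𝒪[K].subtype) y ∈ 𝒪[K]) {y : K} (hy : y * σ y = -2)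
    {c : ↥(unitaryGroupOfForm σ J)} (hc : ((c : GL (Fin 3) K) : Matrix (Fin 3) (Fin 3) K) = !![1, 0, 0; 0, -1, 0; 0, 0, 1])
    (u : ℕ → ↥(unitaryGroupOfForm σ J))
    (hu : ∀ m, ((u m : GL (Fin 3) K) : Matrix (Fin 3) (Fin 3) K) = !![ϖ ^ m, y, (ϖ ^ m)⁻¹; 0, 1, -σ y * (ϖ ^ m)⁻¹; 0, 0, (ϖ ^ m)⁻¹])
    {R : Type u} [CommRing R] [IsDomain R] [IsDiscreteValuationRing R] [IsAdicComplete (IsLocalRing.maximalIdeal R) R]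
    (ι : R →+* K) (hι : Function.Injective ι)
    (hιv : ∀ x : K, Valued.v x ≤ 1 ↔ x ∈ Set.range ι) (σR : R →+* R) (hσR : ∀ r, σR (σR r) = r) (hσι : ∀ r, ι (σR r) = σ (ι r))
    {dR : R} (hdRσ : σR dR = -dR) (hdRu : IsUnit dR) (h2R : IsUnit (2 : R)) {ϖR : R} (hϖR : Irreducible ϖR) (hιϖ : ι ϖR = ϖ)
    {ρ : K} (hvρ : Valued.v ρ = Valued.v ϖ) (hσρ : σ ρ = ρ)
    {t : ↥(unitaryGroupOfForm σ J)} {A B C b₀ : K} (hte : ((t : GL (Fin 3) K) : Matrix (Fin 3) (Fin 3) K) = !![A, 0, B; 0, b₀, 0; C, 0, A])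
    (htH : t ∈ Subgroup.centralizer ({c} : Set ↥(unitaryGroupOfForm σ J))) (hBC : B = C * ρ)
    (r : ℕ → ↥(Subgroup.centralizer ({c} : Set ↥(unitaryGroupOfForm σ J))))
    (hr0 : ∀ a : ℕ, (((r (2 * a) : ↥(unitaryGroupOfForm σ J)) : GL (Fin 3) K) : Matrix (Fin 3) (Fin 3) K) = !![(ϖ ^ a)⁻¹, 0, 0; 0, 1, 0; 0, 0, ϖ ^ a])
    (hr1 : ∀ a : ℕ, (((r (2 * a + 1) : ↥(unitaryGroupOfForm σ J)) : GL (Fin 3) K) : Matrix (Fin 3) (Fin 3) K) =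
      !![0, 0, ϖ ^ (a + 1) / ι dR; 0, 1, 0; -ι dR * (ϖ ^ (a + 1))⁻¹, 0, 0])
    {N Np : ℕ} (hvC : Valued.v C = Valued.v (ϖ ^ N)) (hs : Valued.v (A - b₀) = Valued.v (ϖ ^ Np))
    {q : ℕ} (hq : Nat.card (ResidueField 𝒪[K]) = q ^ 2) (hqR : Nat.card (ResidueField R) = q ^ 2) (hq1 : 1 < q)
    {a₀ : 𝒪[K]} (ha₀ : IsUnit (((σ.comp 𝒪[K].subtype).codRestrict 𝒪[K] hσO) a₀ - a₀))
    (hfin : {x : ↥(unitaryGroupOfForm σ J) ⧸ unitaryInt σ J | t • x = x}.Finite) :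
    (Nat.card {x : ↥(unitaryGroupOfForm σ J) ⧸ unitaryInt σ J | t • x = x} : ℚ) = phiTHM q Np N := by
  have hϖ0 : ϖ ≠ 0 := hd.ϖ_ne_zero
  have hC : C ≠ 0 := fun h => by rw [h, map_zero] at hvC; exact (pow_ne_zero _ hϖ0) ((map_eq_zero _).1 hvC.symm)
  have hvd : Valued.v (ι dR) = 1 := v_map_eq_one_of_isUnit ι hιv hdRu
  have hvπ₀ : Valued.v (ι dR ^ 2 * ρ) = WithZero.exp (-1 : ℤ) := by rw [map_mul, map_pow, hvd, one_pow, one_mul, hvρ, hd.vϖ]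
  exact natCard_fixedPoints_unitaryInt_ramifiedTorus_eq_phiTHM_of_bridge σ hJ hd hσO hy hc u hu ι hι hιv σR hσR hσι hdRσ hdRu h2R hvρ hσρ rfl
    (fun G hG _ hdet => exists_ramifiedMars_coords hvπ₀ σ G hG hdet) hte htH hBC r hr0 hr1 hvC hs hq hq1
    (fun n => relIndex_flickerKH_conj_ramifiedRep_eq σ hJ hd ι hι hιv σR hσR hσι hdRσ hdRu h2R hϖR hιϖ hqR hc hvρ htH hte hC hBC r hr0 hr1 n)
    ha₀ hfin

end THFinal

end UnitaryGroup

end Literature.NumberTheory.Automorphic
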